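/-
Copyright (c) 2026 the pub-hodgecm-mathlib formalisation cell (harness21).  Prover seat hodgecm-mathlib-B-p14 (g35): road «S3-tree» (census «S3» v2 §4 (R-T); architect
A-p16 (g28) S3-W2 «T1 = B-p14 census b6bae4c8: rank-3 twin of ★ `HermitianLatticeTree*`»), brick T1, file T1a = THE DEFINITIONS; 2026-09-01.
Adapted from ★ `HermitianLatticeTreeDefs` (A-p17 (g22), rank 2, `ValuativeRel` currency) to rank `N` in the `Valued K ℤᵐ⁰` ∕ `stdLattice` currency of the ★ `U(N)` kit.
-/
import Literature.NumberTheory.Automorphic.HyperspecialUnitaryRootStarTransitive   -- ★ B-p14 (g35): root-star transitivity; brings ★ `B₀`, `stdLattice`, `unitaryInt`, `map_toLin'_mul`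
import Literature.NumberTheory.Automorphic.UnitaryGroupFormTransport              -- ★ `formCongr σ T H = (σT)ᵀ H T`
import HarnessLib

/-!
# The lattice graph of a hermitian space `(K^N, H)` over a discretely valued field — DEFINITIONS: vertices `ϖM^♯ ≤ M ≤ M^♯` typed by `d = v(det Gram)`,
# incidence, dual lattice, depth and parent below the root `𝒪^N`, and the action of `U(σ, H)` (Bruhat–Tits 1972 §10; Tits 1979 §3.3.3; Serre, *Trees* II.1.1)

Topic `NumberTheory/Automorphic`; namespace `Literature.NumberTheory.Automorphic.UnitaryLatticeTree`.  DEFINITIONS WITH BODIES + their unfolding ∕ bookkeeping lemmas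
(no named fact, no `sorry`, no instance, no notation).  Cell `pub/hodgecm-mathlib` (D-0151), crux H413 = `stmt-HodgeConjecture-24833`; road «S3-tree» (LEAD F0P3a-plan, architect
A-p16 (g28): S3-T0 GREEN ⇒ census «S3» v2 §4 (R-T)), brick **T1 «the `U(3)_v` tree + `U(3)_v`-action + stabilisers»**, file **T1a** of the plan in
`F0/P3a/B-p14/g35/CENSUS-T1-U3Tree.B-p14g35.md` §4 (T1b dual calculus ∕ (D1)–(D4), T1c type-two frames, T1d `isTree`, T1e shells are THEOREM sequels).  This is the rank-`N`
sibling of ★ `HermitianLatticeTreeDefs` (rank 2, `ValuativeRel E`), typed in the `Valued K ℤᵐ⁰` currency of the ★ hyperspecial kit it consumes (★ `exists_frame_cartan`, ★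
`exists_cartan_antidiagonal`, ★ `exists_mem_unitaryGroupOfForm_mul_of_selfDual`, ★ `HyperspecialUnitaryRankOneHeckeNeighbours`, ★ `HyperspecialUnitaryRootStarTransitive`).
HONEST LABEL: HC_CM is proved only modulo the 2 remaining named inputs (hLiu418 24832, h413 24833) until rung 0 closes; nothing printed is asserted here (elementary lattice
algebra over a valuation ring); S3 stays a print row until the road's END lands.

THE OBJECT.  `K` a field with `Valued K ℤᵐ⁰` (`𝒪 = 𝒪[K]`), `σ : K →+* K` (the conjugation of a quadratic `K ∕ K^σ`, used only through Gram matrices), `ϖ ∈ K` (a uniformiser),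
`H ∈ M_N(K)` (a hermitian matrix: the form; the consumers take `H = J₀ = antidiag(1,…,1)`, whose form is ★ `B₀ σ N`).  LATTICES: `latt g := g · 𝒪^N` (image of ★ `stdLattice K N`);
the GRAM MATRIX of `latt g` in the column basis is ★ `formCongr σ g H = (σg)ᵀ H g`, and its DUAL LATTICE is `(latt g)^♯ = latt (g · (formCongr σ g H)⁻¹)` (§2, proved in T1b).
A VERTEX OF TYPE `d` is a lattice `M = latt g` whose Gram matrix `G` is integral with `ϖ·G⁻¹` integral and `v(det G) = v(ϖ)^d` — i.e. `ϖM^♯ ≤ M ≤ M^♯` with `M^♯ ∕ M` of length `d`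
([AbramenkoNebe-type lattice-chain model of the unitary building]; `d = 0`: SELF-DUAL = hyperspecial; at `N = 3` the only other type is `d = 2` — «type one» of the S3-T0 tables,
«almost self-dual»: `v(det G) = 2·v(det g)` is even, so `d ∈ {1, 3}` never occurs, census §1; at `N = 2`, `d = 2` is the `ϖ`-MODULAR type of ★ `HermitianLatticeTreeDefs`).
INCIDENCE: two vertices are adjacent iff one is STRICTLY CONTAINED in the other (then automatically `M < M′ ≤ M′^♯ ≤ M^♯`, census §1); at `N = 3` this is the bipartite
`(q³+1, q+1)`-tree of the unramified `U(3)` (self-dual — type-two edges `ϖL ≤ M ≤ L`), at `N = 2` the tree of ★ `HermitianLatticeTreeDefs`.  ROOTED STRUCTURE at `L₀ = 𝒪^N = latt 1`: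
`latticeDepth ϖ M = min {k | ϖ^k L₀ ≤ M}` and `latticeParent σ ϖ H M = M^♯ ⊓ ϖ^{1−k} L₀` (the neighbour towards the root; T1d proves it).  ACTION: `u ∈ U(σ, H)` acts by `M ↦ u·M`,
preserving Gram matrices, hence every type, inclusion and scaling: a graph automorphism `latticeGraphIso`.

* §1 `latt`, `scaleLattice`, `IsIntMatrix`, `IsVertexLattice σ ϖ H d`, `IsSelfDualLattice` (`d = 0`), `IsVertex` (some `d`); unfoldings `latt_one`, `latt_mul`, `scaleLattice_map`.
* §2 `dualLatt σ H M = {x | ∀ y ∈ M, |pairing σ H y x| ≤ 1}` over the sesquilinear `pairing σ H` of `H` (+ `pairing_apply`, `mem_dualLatt`).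
* §3 `latticeGraph σ ϖ H : SimpleGraph {M // IsVertex σ ϖ H M}` (+ `latticeGraph_adj_iff`), `latticeDepth`, `latticeParent`.
* §4 the action: `mapGL` (+ `mapGL_latt`, `mapGL_mul`, `mapGL_one`, `mapGL_le_mapGL_iff`, `mapGL_lt_mapGL_iff`, `mapGL_scaleLattice`; rank-`N` twins of the `Fin 2` lemmas of ★
  `HermitianLatticeTreeDefs`, which cannot be cited at rank `N`), `isVertexLattice_mapGL`,
  `isVertex_mapGL`, the permutation `latticeGraphPerm` and the GRAPH AUTOMORPHISM **`latticeGraphIso σ ϖ H u`** (+ `latticeGraphIso_apply_coe`).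

## References
* [BruhatTits1972] F. Bruhat, J. Tits, *Groupes réductifs sur un corps local I*, Publ. Math. IHÉS 41 (1972), §10 (the building of a rank-one group is a tree; lattice models for classical groups).
* [Tits1979] J. Tits, *Reductive groups over local fields*, PSPM 33.1 (1979), §3.3.3 (hyperspecial `K₀ = 𝒢(𝒪)`), §2.4 (quasi-split unitary groups: local index and vertex types).
* [Serre1980Trees] J.-P. Serre, *Trees* (1980), Ch. II §1.1 (the tree of `SL₂`: lattices, adjacency, distance from a base lattice).
* [Jacobowitz1962] R. Jacobowitz, *Hermitian forms over local fields*, Amer. J. Math. 84 (1962), §4, §7–§8 (Gram matrices, unimodular and `𝔭`-modular hermitian lattices).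
-/

set_option autoImplicit false

noncomputable section

open scoped Valued WithZero Matrix MatrixGroups

namespace Literature.NumberTheory.Automorphic.UnitaryLatticeTree

open Literature.NumberTheory.Automorphic Literature.NumberTheory.Automorphic.HermitianLattice

variable {K : Type*} [Field K] [Valued K ℤᵐ⁰] {N : ℕ}

/-! ## §1 Lattices, scaling, Gram integrality, vertex types -/

/-- The `𝒪`-lattice `latt g = g · 𝒪^N ⊂ K^N` spanned by the COLUMNS of `g ∈ M_N(K)` (image of ★ `stdLattice K N` under `g`). [cite: Serre1980Trees, II.1.1] -/
def latt (g : Matrix (Fin N) (Fin N) K) : Submodule 𝒪[K] (Fin N → K) :=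
  (stdLattice K N).map ((Matrix.toLin' g).restrictScalars 𝒪[K])

/-- The homothetic lattice `c · M` (`c ∈ K`). [cite: Serre1980Trees, II.1.1] -/
def scaleLattice (c : K) (M : Submodule 𝒪[K] (Fin N → K)) : Submodule 𝒪[K] (Fin N → K) :=
  M.map ((c • (LinearMap.id : (Fin N → K) →ₗ[K] (Fin N → K))).restrictScalars 𝒪[K])

/-- A matrix is INTEGRAL if all its entries lie in `𝒪` (`v ≤ 1`; the spelling of ★ `unitaryInt`). [cite: Tits1979, §3.3.3] -/
def IsIntMatrix (M : Matrix (Fin N) (Fin N) K) : Prop := ∀ i j, Valued.v (M i j) ≤ 1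

/-- **A VERTEX LATTICE OF TYPE `d`** for `(σ, ϖ, H)`: `M = latt g` with Gram matrix `G = (σg)ᵀ H g` such that `G` and `ϖ·G⁻¹` are integral and `v(det G) = v(ϖ)^d` — i.e.
`ϖM^♯ ≤ M ≤ M^♯` with `M^♯ ∕ M` of length `d` (`d = 0`: self-dual; `N = 3`: the second type is `d = 2`; `N = 2`: `d = 2` is `ϖ`-modular). [cite: Jacobowitz1962, §7–§8] [cite: BruhatTits1972, §10] -/
def IsVertexLattice (σ : K →+* K) (ϖ : K) (H : Matrix (Fin N) (Fin N) K) (d : ℕ) (M : Submodule 𝒪[K] (Fin N → K)) : Prop :=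
  ∃ g : GL (Fin N) K, M = latt (g : Matrix (Fin N) (Fin N) K) ∧ IsIntMatrix (formCongr σ g H) ∧ IsIntMatrix (ϖ • (formCongr σ g H)⁻¹) ∧
    Valued.v (formCongr σ g H).det = Valued.v ϖ ^ d

/-- A SELF-DUAL lattice = a vertex of type `0` (unimodular Gram matrix; the hyperspecial vertices). [cite: Jacobowitz1962, §7] -/
abbrev IsSelfDualLattice (σ : K →+* K) (ϖ : K) (H : Matrix (Fin N) (Fin N) K) (M : Submodule 𝒪[K] (Fin N → K)) : Prop :=
  IsVertexLattice σ ϖ H 0 M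

/-- A VERTEX: a vertex lattice of some type. [cite: BruhatTits1972, §10] -/
def IsVertex (σ : K →+* K) (ϖ : K) (H : Matrix (Fin N) (Fin N) K) (M : Submodule 𝒪[K] (Fin N → K)) : Prop :=
  ∃ d : ℕ, IsVertexLattice σ ϖ H d M

/-- `latt 1 = 𝒪^N` (the root `L₀`). [cite: Serre1980Trees, II.1.1] -/
theorem latt_one : latt (1 : Matrix (Fin N) (Fin N) K) = stdLattice K N := map_toLin'_one _

/-- `latt (P g) = P · latt g`. [cite: Serre1980Trees, II.1.1] -/
theorem latt_mul (P g : Matrix (Fin N) (Fin N) K) : latt (P * g) = (latt g).map ((Matrix.toLin' P).restrictScalars 𝒪[K]) := map_toLin'_mul P g _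

/-- Scaling commutes with images under `P ∈ M_N(K)`. [cite: Serre1980Trees, II.1.1] -/
theorem scaleLattice_map (c : K) (P : Matrix (Fin N) (Fin N) K) (M : Submodule 𝒪[K] (Fin N → K)) :
    scaleLattice c (M.map ((Matrix.toLin' P).restrictScalars 𝒪[K])) = (scaleLattice c M).map ((Matrix.toLin' P).restrictScalars 𝒪[K]) := by
  rw [scaleLattice, scaleLattice, ← Submodule.map_comp, ← Submodule.map_comp]
  congr 1
  apply LinearMap.ext
  intro x
  simp

/-! ## §2 The sesquilinear pairing of `H` and the dual lattice -/

/-- The `σ`-sesquilinear pairing of the matrix `H`: `pairing σ H x y = Σ_{i,j} σ(x_i) H_{ij} y_j = (σx)ᵀ H y` (for `H = J₀` this is ★ `B₀ σ N`). [cite: Jacobowitz1962, §4] -/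
def pairing (σ : K →+* K) (H : Matrix (Fin N) (Fin N) K) : (Fin N → K) →ₛₗ[σ] (Fin N → K) →ₗ[K] K :=
  LinearMap.mk₂'ₛₗ σ (RingHom.id K) (fun x y => ∑ i, ∑ j, σ (x i) * H i j * y j)
    (fun x x' y => by simp only [Pi.add_apply, map_add, add_mul, Finset.sum_add_distrib])
    (fun a x y => by simp only [Pi.smul_apply, smul_eq_mul, map_mul, mul_assoc, Finset.mul_sum])
    (fun x y y' => by simp only [Pi.add_apply, mul_add, Finset.sum_add_distrib])
    (fun a x y => by
      simp only [Pi.smul_apply, smul_eq_mul, RingHom.id_apply, Finset.mul_sum]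
      exact Finset.sum_congr rfl fun i _ => Finset.sum_congr rfl fun j _ => by ring)

omit [Valued K ℤᵐ⁰] in
/-- `pairing σ H x y = Σ_{i,j} σ(x_i) H_{ij} y_j`. [cite: Jacobowitz1962, §4] -/
@[simp] theorem pairing_apply (σ : K →+* K) (H : Matrix (Fin N) (Fin N) K) (x y : Fin N → K) :
    pairing σ H x y = ∑ i, ∑ j, σ (x i) * H i j * y j := rfl

/-- **The DUAL LATTICE `M^♯ = {x | ∀ y ∈ M, (σy)ᵀ H x ∈ 𝒪}`** of an `𝒪`-submodule `M ⊆ K^N` for the form `H`. [cite: Jacobowitz1962, §4] [cite: Serre1980Trees, II.1.1] -/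
def dualLatt (σ : K →+* K) (H : Matrix (Fin N) (Fin N) K) (M : Submodule 𝒪[K] (Fin N → K)) : Submodule 𝒪[K] (Fin N → K) where
  carrier := {x | ∀ y ∈ M, Valued.v (pairing σ H y x) ≤ 1}
  add_mem' {a b} ha hb y hy := by
    rw [map_add]
    exact (Valuation.map_add _ _ _).trans (max_le (ha y hy) (hb y hy))
  zero_mem' y _ := by simp
  smul_mem' c {x} hx y hy := by
    change Valued.v (pairing σ H y ((c : K) • x)) ≤ 1
    rw [map_smul, smul_eq_mul, map_mul]
    exact mul_le_one' ((mem_integer_iff' _).1 c.2) (hx y hy)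

/-- Membership in the dual lattice. [cite: Jacobowitz1962, §4] -/
theorem mem_dualLatt (σ : K →+* K) (H : Matrix (Fin N) (Fin N) K) (M : Submodule 𝒪[K] (Fin N → K)) (x : Fin N → K) :
    x ∈ dualLatt σ H M ↔ ∀ y ∈ M, Valued.v (pairing σ H y x) ≤ 1 := Iff.rfl

/-- The dual lattice is antitone. [cite: Jacobowitz1962, §4] -/
theorem dualLatt_antitone (σ : K →+* K) (H : Matrix (Fin N) (Fin N) K) {M M' : Submodule 𝒪[K] (Fin N → K)} (h : M ≤ M') :
    dualLatt σ H M' ≤ dualLatt σ H M := fun _ hx y hy => hx y (h hy)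

/-! ## §3 The graph, depth and parent -/

/-- **THE LATTICE GRAPH of `(K^N, H)`**: vertices the vertex lattices (`ϖM^♯ ≤ M ≤ M^♯`), an edge between two vertices iff one is STRICTLY CONTAINED in the other
(then `M < M′ ≤ M^♯`).  At `N = 3` this is the Bruhat–Tits TREE of the quasi-split `U(3)` (self-dual — type-two edges `ϖL ≤ M ≤ L`; T1d `isTree`), at `N = 2` the tree
of ★ `HermitianLatticeTreeDefs`. [cite: BruhatTits1972, §10] [cite: Serre1980Trees, II.1.1] -/
def latticeGraph (σ : K →+* K) (ϖ : K) (H : Matrix (Fin N) (Fin N) K) : SimpleGraph {M : Submodule 𝒪[K] (Fin N → K) // IsVertex σ ϖ H M} :=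
  SimpleGraph.fromRel fun M M' => M.1 < M'.1

/-- Unfolding of the adjacency of `latticeGraph`: strict comparability. [cite: Serre1980Trees, II.1.1] -/
theorem latticeGraph_adj_iff (σ : K →+* K) (ϖ : K) (H : Matrix (Fin N) (Fin N) K) (M M' : {M : Submodule 𝒪[K] (Fin N → K) // IsVertex σ ϖ H M}) :
    (latticeGraph σ ϖ H).Adj M M' ↔ M.1 < M'.1 ∨ M'.1 < M.1 := by
  rw [latticeGraph, SimpleGraph.fromRel_adj]
  constructor
  · exact fun h => h.2
  · intro h
    refine ⟨fun hMM => ?_, h⟩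
    rcases h with h | h <;> exact (ne_of_lt h) (by rw [hMM])

/-- The DEPTH of a lattice `M` below the root `L₀ = 𝒪^N`: the least `k : ℕ` with `ϖ^k L₀ ≤ M` (`0` if there is none — never the case for a lattice `latt g`).  At `N = 3` a self-dual
vertex of depth `k` is at distance `2k` from `L₀` in the tree, a type-two one at distance `2k − 1`. [cite: Serre1980Trees, II.1.1] -/
def latticeDepth (ϖ : K) (M : Submodule 𝒪[K] (Fin N → K)) : ℕ :=
  sInf {k : ℕ | scaleLattice (ϖ ^ k) (stdLattice K N) ≤ M}

/-- The PARENT of a vertex `M` of depth `k ≥ 1` — its neighbour towards the root: `M^♯ ⊓ ϖ^{1−k} L₀` (for a self-dual `M = ψ·latt diag(ϖ^{-k},1,ϖ^k)` at `N = 3` this is the type-two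
`ψ·latt diag(ϖ^{1-k},1,ϖ^k)`, for a type-two `N = ψ·latt diag(ϖ^{1-k},1,ϖ^k)` the self-dual `ψ·latt diag(ϖ^{1-k},1,ϖ^{k-1})`; T1d `latticeParent_spec`). [cite: Serre1980Trees, II.1.1] -/
def latticeParent (σ : K →+* K) (ϖ : K) (H : Matrix (Fin N) (Fin N) K) (M : Submodule 𝒪[K] (Fin N → K)) : Submodule 𝒪[K] (Fin N → K) :=
  dualLatt σ H M ⊓ scaleLattice (ϖ ^ (1 - (latticeDepth ϖ M : ℤ))) (stdLattice K N)

/-! ## §4 The action of `U(σ, H)`: a type-preserving graph automorphism -/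

section Action

variable (σ : K →+* K) (ϖ : K) (H : Matrix (Fin N) (Fin N) K)

/-- The image of a lattice under `g ∈ GL_N(K)`. [cite: Serre1980Trees, II.1.1] -/
def mapGL (g : GL (Fin N) K) (M : Submodule 𝒪[K] (Fin N → K)) : Submodule 𝒪[K] (Fin N → K) :=
  M.map ((Matrix.toLin' (g : Matrix (Fin N) (Fin N) K)).restrictScalars 𝒪[K])

/-- `g · latt h = latt (g h)`. [cite: Serre1980Trees, II.1.1] -/
theorem mapGL_latt (g h : GL (Fin N) K) : mapGL g (latt (h : Matrix (Fin N) (Fin N) K)) = latt ((g * h : GL (Fin N) K) : Matrix (Fin N) (Fin N) K) := by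
  rw [mapGL, Units.val_mul, latt_mul]

/-- `(g h) · M = g · (h · M)`. [cite: Serre1980Trees, II.1.1] -/
theorem mapGL_mul (g h : GL (Fin N) K) (M : Submodule 𝒪[K] (Fin N → K)) : mapGL (g * h) M = mapGL g (mapGL h M) := by
  rw [mapGL, mapGL, mapGL, Units.val_mul]
  exact map_toLin'_mul _ _ M

/-- `1 · M = M`. [cite: Serre1980Trees, II.1.1] -/
theorem mapGL_one (M : Submodule 𝒪[K] (Fin N → K)) : mapGL 1 M = M := by
  rw [mapGL, Units.val_one]
  exact map_toLin'_one M

/-- `g ·` is monotone and order-reflecting. [cite: Serre1980Trees, II.1.1] -/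
theorem mapGL_le_mapGL_iff (g : GL (Fin N) K) (M M' : Submodule 𝒪[K] (Fin N → K)) : mapGL g M ≤ mapGL g M' ↔ M ≤ M' := by
  constructor
  · intro h
    have h' := Submodule.map_mono (f := (Matrix.toLin' ((g⁻¹ : GL (Fin N) K) : Matrix (Fin N) (Fin N) K)).restrictScalars 𝒪[K]) h
    change mapGL g⁻¹ (mapGL g M) ≤ mapGL g⁻¹ (mapGL g M') at h'
    rwa [← mapGL_mul, ← mapGL_mul, inv_mul_cancel, mapGL_one, mapGL_one] at h'
  · exact fun h => Submodule.map_mono h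

/-- `g ·` is injective on lattices. [cite: Serre1980Trees, II.1.1] -/
theorem mapGL_injective (g : GL (Fin N) K) : Function.Injective (mapGL g : Submodule 𝒪[K] (Fin N → K) → Submodule 𝒪[K] (Fin N → K)) := fun M M' h =>
  le_antisymm ((mapGL_le_mapGL_iff g M M').1 h.le) ((mapGL_le_mapGL_iff g M' M).1 h.ge)

/-- `g ·` preserves and reflects strict containment. [cite: Serre1980Trees, II.1.1] -/
theorem mapGL_lt_mapGL_iff (g : GL (Fin N) K) (M M' : Submodule 𝒪[K] (Fin N → K)) : mapGL g M < mapGL g M' ↔ M < M' := by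
  rw [lt_iff_le_and_ne, lt_iff_le_and_ne, mapGL_le_mapGL_iff, (mapGL_injective g).ne_iff]

/-- `g ·` commutes with scaling. [cite: Serre1980Trees, II.1.1] -/
theorem mapGL_scaleLattice (g : GL (Fin N) K) (c : K) (M : Submodule 𝒪[K] (Fin N → K)) : mapGL g (scaleLattice c M) = scaleLattice c (mapGL g M) := by
  rw [mapGL, mapGL, scaleLattice_map]

omit [Valued K ℤᵐ⁰] in
/-- A unitary `u` preserves Gram matrices: `formCongr σ (u g) H = formCongr σ g H` — the rank-`N` form of ★ `HermitianLatticeTree.formCongr_unitary_mul` (stated there at `N = 2`;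
kept private here, the public users are `isVertexLattice_mapGL` and its corollaries). [cite: Jacobowitz1962, §4] -/
private theorem formCongr_unitary_mul_rankN (u : GL (Fin N) K) (hu : u ∈ unitaryGroupOfForm σ H) (g : GL (Fin N) K) : formCongr σ (u * g) H = formCongr σ g H := by
  have hu' : ((u : Matrix (Fin N) (Fin N) K).map σ)ᵀ * H * (u : Matrix (Fin N) (Fin N) K) = H := hu
  simp only [formCongr, Units.val_mul, Matrix.map_mul, Matrix.transpose_mul]
  rw [show ((g : Matrix (Fin N) (Fin N) K).map σ)ᵀ * ((u : Matrix (Fin N) (Fin N) K).map σ)ᵀ * H * ((u : Matrix (Fin N) (Fin N) K) * (g : Matrix (Fin N) (Fin N) K)) =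
    ((g : Matrix (Fin N) (Fin N) K).map σ)ᵀ * ((((u : Matrix (Fin N) (Fin N) K).map σ)ᵀ * H * (u : Matrix (Fin N) (Fin N) K))) * (g : Matrix (Fin N) (Fin N) K) by
      simp only [Matrix.mul_assoc], hu']

/-- A unitary `u` maps vertices of type `d` to vertices of type `d`. [cite: BruhatTits1972, §10] [cite: Jacobowitz1962, §7–§8] -/
theorem isVertexLattice_mapGL (u : GL (Fin N) K) (hu : u ∈ unitaryGroupOfForm σ H) {d : ℕ} {M : Submodule 𝒪[K] (Fin N → K)}
    (hM : IsVertexLattice σ ϖ H d M) : IsVertexLattice σ ϖ H d (mapGL u M) := by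
  obtain ⟨g, rfl, hG, hG', hdet⟩ := hM
  exact ⟨u * g, mapGL_latt u g, by rwa [formCongr_unitary_mul_rankN σ H u hu], by rwa [formCongr_unitary_mul_rankN σ H u hu], by rwa [formCongr_unitary_mul_rankN σ H u hu]⟩

/-- A unitary `u` maps vertices to vertices. [cite: BruhatTits1972, §10] -/
theorem isVertex_mapGL (u : GL (Fin N) K) (hu : u ∈ unitaryGroupOfForm σ H) {M : Submodule 𝒪[K] (Fin N → K)} (hM : IsVertex σ ϖ H M) :
    IsVertex σ ϖ H (mapGL u M) := by
  obtain ⟨d, hd⟩ := hM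
  exact ⟨d, isVertexLattice_mapGL σ ϖ H u hu hd⟩

/-- **The action of `u ∈ U(σ, H)` on the vertices**, as a permutation. [cite: BruhatTits1972, §10] -/
def latticeGraphPerm (u : unitaryGroupOfForm σ H) :
    {M : Submodule 𝒪[K] (Fin N → K) // IsVertex σ ϖ H M} ≃ {M : Submodule 𝒪[K] (Fin N → K) // IsVertex σ ϖ H M} where
  toFun v := ⟨mapGL (u : GL (Fin N) K) v.1, isVertex_mapGL σ ϖ H _ u.2 v.2⟩
  invFun v := ⟨mapGL ((u⁻¹ : unitaryGroupOfForm σ H) : GL (Fin N) K) v.1, isVertex_mapGL σ ϖ H _ (u⁻¹).2 v.2⟩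
  left_inv v := by apply Subtype.ext; change mapGL _ (mapGL _ v.1) = v.1; rw [← mapGL_mul, Subgroup.coe_inv, inv_mul_cancel, mapGL_one]
  right_inv v := by apply Subtype.ext; change mapGL _ (mapGL _ v.1) = v.1; rw [← mapGL_mul, Subgroup.coe_inv, mul_inv_cancel, mapGL_one]

/-- **`u ∈ U(σ, H)` ACTS ON THE LATTICE GRAPH BY A GRAPH AUTOMORPHISM** (it preserves types and strict inclusions). [cite: BruhatTits1972, §10] [cite: Serre1980Trees, II.1.1] -/
def latticeGraphIso (u : unitaryGroupOfForm σ H) : latticeGraph σ ϖ H ≃g latticeGraph σ ϖ H where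
  toEquiv := latticeGraphPerm σ ϖ H u
  map_rel_iff' := by
    intro v w
    change (latticeGraph σ ϖ H).Adj ⟨mapGL (u : GL (Fin N) K) v.1, _⟩ ⟨mapGL (u : GL (Fin N) K) w.1, _⟩ ↔ (latticeGraph σ ϖ H).Adj v w
    rw [latticeGraph_adj_iff, latticeGraph_adj_iff]
    simp only [mapGL_lt_mapGL_iff]

/-- The automorphism on underlying lattices: `(latticeGraphIso u v).1 = u · v.1`. [cite: BruhatTits1972, §10] -/
theorem latticeGraphIso_apply_coe (u : unitaryGroupOfForm σ H) (v : {M : Submodule 𝒪[K] (Fin N → K) // IsVertex σ ϖ H M}) :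
    ((latticeGraphIso σ ϖ H u v : {M : Submodule 𝒪[K] (Fin N → K) // IsVertex σ ϖ H M}) : Submodule 𝒪[K] (Fin N → K)) =
      v.1.map ((Matrix.toLin' ((u : GL (Fin N) K) : Matrix (Fin N) (Fin N) K)).restrictScalars 𝒪[K]) := rfl

/-- The type is preserved under the action, in `iff` form. [cite: BruhatTits1972, §10] -/
theorem isVertexLattice_mapGL_iff (u : unitaryGroupOfForm σ H) {d : ℕ} (M : Submodule 𝒪[K] (Fin N → K)) :
    IsVertexLattice σ ϖ H d (mapGL (u : GL (Fin N) K) M) ↔ IsVertexLattice σ ϖ H d M := by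
  constructor
  · intro h
    have h' := isVertexLattice_mapGL σ ϖ H _ (u⁻¹).2 h
    rwa [← mapGL_mul, Subgroup.coe_inv, inv_mul_cancel, mapGL_one] at h'
  · exact isVertexLattice_mapGL σ ϖ H _ u.2

end Action

end Literature.NumberTheory.Automorphic.UnitaryLatticeTree

end
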